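import Literature.IUT.HodgeTheaters.PuncturedEllipticCoveringsCor12InertiaCentralOfStar
import Literature.IUT.HodgeTheaters.PuncturedEllipticCoveringsCor12OfOriginLawsModLFields
import Mathlib.Tactic.Group
import HarnessLib

/-!
# [IUTchI] §1 p. 37–38 — every cusp of `X̲` is `k`-rational (its decomposition group surjects onto `G_k`)
# FROM the cusp action `CuspGalois`; hence the law (L4) `ModLCuspLaws.inertia_central` from (∗) + (A) + (c′)
# under the binders the Cor. 1.2 closers already carry — proof-only

Mochizuki, *Inter-universal Teichmüller theory I: construction of Hodge theaters*, kurims manuscript (May 2020),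
§1 p. 37 l. 20–24 (assumption (∗)) and p. 38 l. 22–24 ("since [in light of the assumption (∗)!] the natural [outer]
action of `G_k` on `Δ_ε⁺ × Gal(X̲/C̲)` is trivial") [cite: Mochizuki2012, IUTchI §1 pp.37-38] (D-0012 claim key;
series status DISPUTED — nothing of the series is asserted here); [EtTh] Def. 2.1 p. 33 ("every cusp of `X̲` is
`K`-rational") [cite: MochizukiEtTh2009, Def 2.1 p.33].

PROOF-ONLY companion (cell abc-iut, seat abc-iut-w4-d051 gen 18, home L5; node `IUTchI:Cor1.2`, L5 ROWS #7 row
R49 «COR12-L4-OF-STAR» — support knit; no definition, no instance, no notation, no new `Prop` fact; nothing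
restated) over abc-iut-L5-t1's `…Cor12InertiaCentralOfStar.lean` (p500241:
`PuncturedEllipticData.inertia_central_of_star_freePro (hfree) (hcusp) (hrat)`), abc-iut-L5-t1's FROZEN
`PuncturedEllipticCoverings.lean` (p404449: the field `aug_decomp_twoε`, "`D_{2ε}` determines a section
`σ : G_k → J_C`", p. 38) and `PuncturedEllipticCoveringsCusps.lean` (p424023: the cusp action `CuspGalois`, fields
`transitive` and `act_decomp`), and abc-iut-f-090's `…Cor12OfOriginLawsModLFields.lean` (the record `ModLCuspLaws`
assembled from (A) + (c) + four label clauses).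

WHAT THIS FILE DOES.  The ONE origin-shaped input that p500241 adds to (∗) + (A) + (c′),
  (r) `∀ x : D.Cusp, Function.Surjective (aug ∘ (D.decomp x).subtype)` — «every cusp of `X̲_k` is `k`-rational»,
is a THEOREM of the cusp action `C : D.CuspGalois` that every [IUTchI] Cor. 1.2 closer already carries as a binder
(`CuspGalois.aug_decomp_surjective`): by `transitive` some `g ∈ Π_X` moves the cusp `2ε̲` to `x`, by `act_decomp`
the representative decomposition group `D_x` is `(t g) · D_{2ε} · (t g)⁻¹` for some `t ∈ Π_X̲`
(`CuspGalois.exists_decomp_eq_conj_decomp_twoε`), and `D_{2ε} ↠ G_k` is the frozen field `aug_decomp_twoε`; the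
image of a conjugate of a subgroup surjecting onto `G_k` is all of `G_k`.  CONSEQUENCES, by name:
* `CuspGalois.inertia_central_of_star_freePro (C) (hfree) (hcusp)` — the field type of (L4)
  `ModLCuspLaws.inertia_central` VERBATIM, from (∗) `star` + (A) + (c′) + `C` (p500241 with `hrat` discharged);
* `GeomOrigin.inertia_central (O) (C)` — the same over abc-iut-L5-t1's origin record;
* `CuspGalois.modLCuspLaws_of_star_freePro (C) (hfree) (hcusp) (hL2a) (hL2c) (hL3)` and
  `GeomOrigin.modLCuspLaws_of_labels (O) (C) (hL2a) (hL2c) (hL3)` — abc-iut-L5-t1's record `ModLCuspLaws`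
  ASSEMBLED with (L0) from (A), (L1) from (c′), (L4) from (∗), and ONLY the three printed `Δ_ε`-level label
  clauses (L2a) "`I_ε′ ≅ ℤ/lℤ` in `Δ_ε`", (L2c) "`0 → I_ε′ × I_ε″ → Δ_ε`", (L3) "`ι` acts on `Δ_E ⊗ ℤ/l` by
  `−1`" displayed (p. 37 l. 34 – p. 38 l. 2).
CENSUS EFFECT (GAP-LEDGER G-L5t1g11-4, abc-iut-L5-lead RULINGS #118 (2)(α)): in the Cor. 1.2 closers the LAW
binders `hL4 hL4′` are discharged WITHOUT a new binder — (r), (r′) are supplied by the DATA binders `C C′`; the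
residual `Δ_ε`-level LAWS are (L2a)(L2c)(L3) × 2.

HONEST FRAMING: classical group theory about OUR typing; (∗) is the datum's own hypothesis FIELD, (A)/(c′) are
origin binders (assumption labels), `C` is the interface datum of p424023 — none is asserted for any instance;
nothing here bears on [IUTchIII] Cor. 3.12 or asserts that abc is proved or refuted; typed ≠ inhabited ≠
discharged; no printed statement is strengthened.
-/

namespace Literature.IUT.HodgeTheaters

namespace PuncturedEllipticData

open scoped Pointwise
open Literature.AnabelianGeometry.AbsoluteAnabelian

universe u

variable {D : PuncturedEllipticData.{u}}

namespace CuspGalois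

variable (C : D.CuspGalois)

include C

/-! ### §1. Every cusp of `X̲` is `k`-rational, from the cusp action -/

/-- **Every representative decomposition group is a `Π_X`-conjugate of `D_{2ε}`**: `D_x = s · D_{2ε} · s⁻¹` for
some `s ∈ Π_X` (`Gal(X̲/X) = Π_X/Π_X̲` acts transitively on the cusps of `X̲`, [EtTh] Def. 2.1; `act_decomp`).
([IUTchI] §1 p.37) [claim: Mochizuki2012, status: disputed] -/
theorem exists_decomp_eq_conj_decomp_twoε (x : D.Cusp) :
    ∃ s ∈ D.PiX, D.decomp x = MulAut.conj s • D.decomp D.twoε := by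
  obtain ⟨g, hgX, hgx⟩ := C.transitive D.twoε x
  obtain ⟨t, ht, hconj⟩ := C.act_decomp g D.twoε
  refine ⟨t * g, D.PiX.mul_mem ((inf_le_left : D.PiXbar ≤ D.PiX) ht) hgX, ?_⟩
  rw [← hgx, hconj]

/-- **Every cusp of `X̲` is `k`-rational** ("every cusp of `X̲` is `K`-rational", [EtTh] Def. 2.1 p. 33; [IUTchI] §1
p. 37–38 treats `ε⁰, ε′, ε″, 2ε` as individual cusps over `k`): the representative decomposition group `D_x` of EVERY
cusp `x` surjects onto `G_k` — from the frozen field `aug_decomp_twoε` (`D_{2ε} ↠ G_k`, "determines a section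
`σ : G_k → J_C`", p. 38) transported along `D_x = s · D_{2ε} · s⁻¹`, `s ∈ Π_X`.  This is the binder (r) `hrat` of
abc-iut-L5-t1's `inertia_central_of_star_freePro` (p500241). ([IUTchI] §1 p.38) [claim: Mochizuki2012, status:
disputed] -/
theorem aug_decomp_surjective (x : D.Cusp) :
    Function.Surjective (D.E.aug.toMonoidHom.comp (D.decomp x).subtype) := by
  intro γ
  obtain ⟨s, -, hs⟩ := C.exists_decomp_eq_conj_decomp_twoε x
  obtain ⟨⟨d, hd⟩, hdγ⟩ := D.aug_decomp_twoε ((D.E.aug s)⁻¹ * γ * D.E.aug s)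
  have hmem : MulAut.conj s • d ∈ MulAut.conj s • D.decomp D.twoε :=
    Subgroup.smul_mem_pointwise_smul _ _ _ hd
  rw [← hs, MulAut.smul_def, MulAut.conj_apply] at hmem
  refine ⟨⟨s * d * s⁻¹, hmem⟩, ?_⟩
  have hd' : D.E.aug d = (D.E.aug s)⁻¹ * γ * D.E.aug s := hdγ
  change D.E.aug (s * d * s⁻¹) = γ
  rw [map_mul, map_mul, map_inv, hd']
  group

/-- `Π_C`-level form: `aug(D_x) = G_k` for every cusp `x` of `X̲` ("every cusp of `X̲` is `K`-rational").
([IUTchI] §1 p.38) [claim: Mochizuki2012, status: disputed] -/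
theorem aug_image_decomp_eq_univ (x : D.Cusp) :
    (D.E.aug : D.PiC → D.E.gal) '' (D.decomp x : Set D.PiC) = Set.univ := by
  refine Set.eq_univ_of_forall fun γ => ?_
  obtain ⟨⟨d, hd⟩, hdγ⟩ := C.aug_decomp_surjective x γ
  exact ⟨d, hd, hdγ⟩

/-! ### §2. (L4) `ModLCuspLaws.inertia_central` from (∗) + (A) + (c′), under the cusp action -/

/-- **[IUTchI] §1 (L4) from (∗), under the binders the Cor. 1.2 closers already carry**: "[in light of the
assumption (∗)!] the natural [outer] action of `G_k` on `Δ_ε⁺ …` is trivial" (p. 38 l. 22–24) at the level of the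
cusp inertia groups — if `Δ_X = Π_X ∩ Δ_C` is free profinite on `a, b` (A) and every cusp inertia group is a
`Δ_X`-conjugate of `⟨[a,b]⟩⁻` (c′), then the field (∗) `star` forces `Π_X̲` to centralise every `I_x` modulo
`Ker(Δ_X̲ ↠ Δ_X̲^{ab} ⊗ ℤ/l)`: VERBATIM the field type of `ModLCuspLaws.inertia_central`.  abc-iut-L5-t1's
`inertia_central_of_star_freePro` (p500241; the mod-`l` Heisenberg quotient of `F̂₂`) with its cusp-rationality
binder (r) DISCHARGED by `aug_decomp_surjective`. ([IUTchI] §1 p.38) [claim: Mochizuki2012, status: disputed] -/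
theorem inertia_central_of_star_freePro {gens : Fin 2 → ↥(D.PiX ⊓ D.DeltaC)}
    (hfree : IsFreeProOn ↥(D.PiX ⊓ D.DeltaC) Set.univ gens)
    (hcusp : ∀ x : D.Cusp, ∃ g ∈ D.PiX ⊓ D.DeltaC,
      D.inertia x = (Subgroup.zpowers (g * ((gens 0 : D.PiC) * (gens 1 : D.PiC) *
        (gens 0 : D.PiC)⁻¹ * (gens 1 : D.PiC)⁻¹) * g⁻¹)).topologicalClosure) :
    ∀ x : D.Cusp, ∀ g ∈ D.PiXbar, ∀ z ∈ D.inertia x, g * z * g⁻¹ * z⁻¹ ∈ D.modLKer :=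
  D.inertia_central_of_star_freePro hfree hcusp C.aug_decomp_surjective

/-- **abc-iut-L5-t1's record `ModLCuspLaws` from (∗) + (A) + (c′) + the cusp action + THREE label clauses**:
(L0) "`Δ_X̲^{ab} ⊗ (ℤ/lℤ)` finite" from (A) (`modLKer_relIndex_ne_zero_of_isFreeProOn`, abc-iut-f-090), (L1) "cusp
inertia procyclic" from (c′) (`inertia_procyclic_of_commutatorCusp`), (L4) "`G_k` acts trivially on `Δ_ε⁺`" from (∗)
(`inertia_central_of_star_freePro`); displayed VERBATIM: (L2a) "`I_ε′ ≅ ℤ/lℤ`" in `Δ_ε`, (L2c)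
"`0 → I_ε′ × I_ε″ → Δ_ε`", (L3) "`ι` acts on `Δ_E ⊗ (ℤ/lℤ)` via multiplication by `−1`" (p. 37 l. 34 – p. 38 l. 2).
([IUTchI] §1 pp.37–38) [claim: Mochizuki2012, status: disputed] -/
theorem modLCuspLaws_of_star_freePro {gens : Fin 2 → ↥(D.PiX ⊓ D.DeltaC)}
    (hfree : IsFreeProOn ↥(D.PiX ⊓ D.DeltaC) Set.univ gens)
    (hcusp : ∀ x : D.Cusp, ∃ g ∈ D.PiX ⊓ D.DeltaC,
      D.inertia x = (Subgroup.zpowers (g * ((gens 0 : D.PiC) * (gens 1 : D.PiC) *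
        (gens 0 : D.PiC)⁻¹ * (gens 1 : D.PiC)⁻¹) * g⁻¹)).topologicalClosure)
    (hL2a : D.deltaEpsKer.relIndex (D.inertia D.ε1 ⊔ D.deltaEpsKer) = D.l)
    (hL2c : D.inertia D.ε1 ⊓ (D.inertia D.ε2 ⊔ D.deltaEpsKer) ≤ D.deltaEpsKer)
    (hL3 : ∀ c ∈ D.DeltaCbar, c ∉ D.DeltaXbar → ∀ v ∈ D.DeltaXbar,
      c * v * c⁻¹ * v ∈ D.inertia D.ε1 ⊔ D.inertia D.ε2 ⊔ D.deltaEpsKer) :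
    D.ModLCuspLaws :=
  D.modLCuspLaws_of_freePro_commutatorCusp hfree hcusp hL2a hL2c hL3
    (C.inertia_central_of_star_freePro hfree hcusp)

end CuspGalois

namespace GeomOrigin

/-- **(L4) over the origin record**: for `O : D.GeomOrigin` ((A)+(c′)) and the cusp action `C : D.CuspGalois`,
the field (∗) `star` yields `ModLCuspLaws.inertia_central` — abc-iut-L5-t1's `GeomOrigin.inertia_central_of_rational`
(p500241) with (r) discharged by `CuspGalois.aug_decomp_surjective`. ([IUTchI] §1 p.38) [claim: Mochizuki2012,
status: disputed] -/
theorem inertia_central (O : D.GeomOrigin) (C : D.CuspGalois) :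
    ∀ x : D.Cusp, ∀ g ∈ D.PiXbar, ∀ z ∈ D.inertia x, g * z * g⁻¹ * z⁻¹ ∈ D.modLKer :=
  D.inertia_central_of_star_freePro O.isFreeProOn O.inertia_eq_conj_commutator C.aug_decomp_surjective

/-- **abc-iut-L5-t1's record `ModLCuspLaws` over the origin record and the cusp action, modulo the three label
clauses (L2a)(L2c)(L3)** — (L0) from (A), (L1) from (c′), (L4) from (∗). ([IUTchI] §1 pp.37–38) [claim:
Mochizuki2012, status: disputed] -/
theorem modLCuspLaws_of_labels (O : D.GeomOrigin) (C : D.CuspGalois)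
    (hL2a : D.deltaEpsKer.relIndex (D.inertia D.ε1 ⊔ D.deltaEpsKer) = D.l)
    (hL2c : D.inertia D.ε1 ⊓ (D.inertia D.ε2 ⊔ D.deltaEpsKer) ≤ D.deltaEpsKer)
    (hL3 : ∀ c ∈ D.DeltaCbar, c ∉ D.DeltaXbar → ∀ v ∈ D.DeltaXbar,
      c * v * c⁻¹ * v ∈ D.inertia D.ε1 ⊔ D.inertia D.ε2 ⊔ D.deltaEpsKer) :
    D.ModLCuspLaws :=
  C.modLCuspLaws_of_star_freePro O.isFreeProOn O.inertia_eq_conj_commutator hL2a hL2c hL3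

end GeomOrigin

end PuncturedEllipticData

end Literature.IUT.HodgeTheaters
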